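import Literature.MathematicalPhysics.QuantumFieldTheory.Balaban1983to89.B11Eq110GreenInverse

/-!
# `Balaban1983to89.B9Eq3147ProjectionOps` — T. Bałaban, *Propagators for lattice gauge theories in a background field*, Commun. Math.
# Phys. **99** (1985) 389–434 [Balaban1985BackgroundPropagators], (3.147) p. 425 `𝔓 = I − G₁Q*(QG₁Q*)⁻¹Q − G₁DRD*` and (3.153) p. 426
# `𝔊 = G₁ − G₁DRD*G₁ − G₁Q*(QG₁Q*)⁻¹QG₁ = G₁𝔓* = 𝔓G₁`, with [Balaban1985Variational] (110)–(111) p. 294 (*«the operator G₁𝔓* is equal to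
# the operator 𝔊 … satisfying the equalities Q𝔊 = 0, RD*𝔊 = 0»*): the operators 𝔓, 𝔓*, 𝔊 AS LINEAR MAPS over the CONSTRUCTED `G₁`,
# `(QG₁Q*)⁻¹` of `B11Eq110GreenInverse`, with the printed properties from the identities (3.124) / «RD*G₁DR = R» as displayed hypotheses

statement-level skeleton of published theorems with citation tags; proofs where landed; nothing here is a claim
about the Yang–Mills mass gap

PDF held: `paper:balaban1985-cmp99-background-propagators` (journal page = PDF page + 388); pp. 424–426 (PDF 36–38) read from the held text by
this seat (`lit read`, 2026-08-21); [B11] p. 294 likewise (`paper:balaban1985-cmp102-variational-background` p. 18).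

THE PRINT (verbatim).  [B9] p. 425: *«𝔓 = I − G₁Q*(QG₁Q*)⁻¹Q − G₁DRD*. (3.147) It is easy to verify explicitly properties of the operator 𝔓, i.e.
Q𝔓 = 0, RD*𝔓 = 0, 𝔓² = 𝔓, if 𝔓^{[*]} denotes an adjoint of 𝔓 in the Hilbert space with the scalar product ⟨X, G₁⁻¹A′⟩, then 𝔓^{[*]} =
G₁𝔓*G₁⁻¹ = G₁(I − Q*(QG₁Q*)⁻¹QG₁ − DRD*G₁)G₁⁻¹ = 𝔓. … Verifying the above properties we need to know only the identities (3.124) and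
RD*G₁DR = R.»*  p. 426: *«𝔊 = G₁ − G₁DRD*G₁ − DG′RG′D* + DG′RG′D*DRG′D* = G₁ − G₁DRD*G₁ − G₁Q*(QG₁Q*)⁻¹QG₁ = G₁𝔓* = 𝔓G₁. (3.153)»*
[B11] p. 294: *«We denote by G₁ an inverse operator to the operator Δ₁ + DRD* + aQ*Q. … A₁ + G₁J + G₁(δ/δA′)V(A₁ + H₁B) = 0. (110) In [5] we
have proved that the operator G₁𝔓* is equal to the operator 𝔊 defined by (3.148) and satisfying the equalities Q𝔊 = 0, RD*𝔊 = 0. Thus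
any solution of (110) satisfies automatically Eq. (108), (109).»*

WHY THIS FILE (cell context).  The tree certifies (3.146)–(3.153) as RING identities over an abstract ring (`B9.frakP`, `frakPstar`,
`frakP_of_3146`, `q_mul_frakP`, `rds_mul_frakP`, `frakP_idem`, `frakG_3150`, `frakG_3153`, hypotheses `h124a/b`, `h152a/b`, `hR`), where
all operators live in ONE ring; the actual operators act between DIFFERENT spaces (`Q : E → F`, `D : S → E`, …).  THIS FILE gives 𝔓, 𝔓*,
𝔊 as genuine linear maps `E →ₗ E` over the inverses CONSTRUCTED in `B11Eq110GreenInverse` (so that `(QG₁Q*)(QG₁Q*)⁻¹ = I` and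
`Δ_{1,a}G₁ = I` are BY CONSTRUCTION), proves `𝔊 = G₁𝔓* = 𝔓G₁` hypothesis-free and the printed `Q𝔓 = RD*𝔓 = 0`, `𝔓² = 𝔓`, `Q𝔊 = RD*𝔊 = 0`
from the two displayed identities, and packages `𝔊`, `H₁` as continuous linear maps — letter (L2) (and (L6)) of the pub-balaban NE9 letter
map at the Hilbert-space level: the `𝒢` of `B11Eq174Chart.Regime` / `B11Prop6Scheme` as an OBJECT modulo the data `Q, Q*, D, D*, R, a`,
the displayed positivity ([B9] Thm 3.11) and the displayed identities (3.124) / «RD*G₁DR = R».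

WHAT IS DEFINED AND PROVED (sorry-free; no `Prop` placeholder; no inequality of the paper).
* §1 `frakP`, `frakPstar`, `frakG` (linear maps `E →ₗ[ℝ] E`; `_apply` unfoldings); **`frakG_eq_G1_comp_frakPstar`** (`𝔊 = G₁𝔓*`) and
  **`G1_comp_frakPstar_eq_frakP_comp_G1`** (`G₁𝔓* = 𝔓G₁`) — hypothesis-free.
* §2 `Q_frakP` (`Q𝔓 = 0` ⇐ (3.124) `QG₁DR = 0`), `RDstar_frakP` (`RD*𝔓 = 0` ⇐ `RD*G₁Q* = 0`, `RD*G₁DR = R`), `frakP_idem` (`𝔓² = 𝔓`),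
  **`Q_frakG`**, **`RDstar_frakG`** ([B11] p. 294's two equalities), `constraints_of_range_frakG` ((110) ⇒ (109)).
* §3 `frakGCLM`, `H1CLM` — 𝔊 and H₁ as continuous linear maps (finite dimension).

MODEL / DECLARED READINGS.  (M1) The typing of `B11Eq110GreenInverse` / `B11Eq127EulerLagrange` (real finite-dimensional inner-product spaces
`E`, `F`, module `S`; `D*`, `Q*` data).  (M2) DISPLAYED, never asserted: positivity `hpos` ([B9] Thm 3.11), `Q*` injective ([B9] (3.19)),
the identities (3.124) in the two forms used (`QG₁DR = 0`, `RD*G₁Q* = 0`) and «`RD*G₁DR = R`» (p. 425: *«can be proved by the same method as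
used in the proof of (3.124)»*) — exactly the hypotheses of the tree's ring lemmas.  (M3) The `G₁⁻¹`-self-adjointness `𝔓^{[*]} = 𝔓` and the
Gaussian-integral characterisations (3.139)–(3.145), (3.148)–(3.152) are not typed here.
HONEST SCOPE.  Finite-dimensional operator algebra realising printed OPERATOR DEFINITIONS as objects; no estimate of the paper ([B9] Thm 3.13
stays a `…Printed` statement); NOT summit progress (cell pub-balaban: NE9 NOT PRINTED / NOT PROVED; spine PROVED 0/9).  Filed by the pub-balaban
NE9 BINDER-row owner lineage `b2b-balaban-t4-ne9-p1` (gen 76); a NEW file importing `B11Eq110GreenInverse` only; nothing of lit-balaban's is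
modified.  Net new unproved facts: 0.
-/

noncomputable section

open scoped InnerProductSpace

namespace Literature.MathematicalPhysics.QuantumFieldTheory.Balaban1983to89.B9Eq3147ProjectionOps

open B11Eq127EulerLagrange (laplaceA)
open B11Eq110GreenInverse (G1 Kinv H1 laplaceA_G1 G1_laplaceA hK_holds)

variable {E : Type*} [NormedAddCommGroup E] [InnerProductSpace ℝ E] [FiniteDimensional ℝ E] {F : Type*} [NormedAddCommGroup F]
  [InnerProductSpace ℝ F] [FiniteDimensional ℝ F] {S : Type*} [AddCommGroup S] [Module ℝ S]
  {Δ : E →ₗ[ℝ] E} {D : S →ₗ[ℝ] E} {R : S →ₗ[ℝ] S} {Dstar : E →ₗ[ℝ] S} {Q : E →ₗ[ℝ] F} {Qadj : F →ₗ[ℝ] E} {a : ℝ}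
  (hpos : ∀ x : E, x ≠ 0 → 0 < ⟪x, laplaceA Δ D R Dstar Q Qadj a x⟫_ℝ) (hadj : ∀ (x : E) (y : F), ⟪Q x, y⟫_ℝ = ⟪x, Qadj y⟫_ℝ)
  (hQadj : Function.Injective Qadj)

/-! ## §1 The operators 𝔓 (3.147), 𝔓* and 𝔊 (3.153) as linear maps over the constructed `G₁`, `(QG₁Q*)⁻¹` -/

/-- **𝔓 of (3.147)**: `𝔓 = I − G₁Q*(QG₁Q*)⁻¹Q − G₁DRD*` as a LINEAR MAP, with `G₁` and `(QG₁Q*)⁻¹` the CONSTRUCTED inverses of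
`B11Eq110GreenInverse` (the tree's `B9.frakP g q qs c d ds r` is the same expression over an abstract ring). [cite: Balaban1985BackgroundPropagators, (3.147) p.425] -/
def frakP : E →ₗ[ℝ] E :=
  LinearMap.id - G1 Δ D R Dstar Q Qadj a hpos ∘ₗ Qadj ∘ₗ Kinv hpos hadj hQadj ∘ₗ Q - G1 Δ D R Dstar Q Qadj a hpos ∘ₗ D ∘ₗ R ∘ₗ Dstar

/-- **𝔓*** (the formal `G₁⁻¹`-adjoint appearing in (3.153)): `𝔓* = I − Q*(QG₁Q*)⁻¹QG₁ − DRD*G₁` (the tree's `B9.frakPstar`).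
[cite: Balaban1985BackgroundPropagators, (3.153) p.426] -/
def frakPstar : E →ₗ[ℝ] E :=
  LinearMap.id - Qadj ∘ₗ Kinv hpos hadj hQadj ∘ₗ Q ∘ₗ G1 Δ D R Dstar Q Qadj a hpos - D ∘ₗ R ∘ₗ Dstar ∘ₗ G1 Δ D R Dstar Q Qadj a hpos

/-- **𝔊 of (3.153)**: `𝔊 = G₁ − G₁DRD*G₁ − G₁Q*(QG₁Q*)⁻¹QG₁` as a LINEAR MAP — the operator of [B11] (110)–(111) (*«In [5] we have proved that
the operator G₁𝔓* is equal to the operator 𝔊 defined by (3.148)»*), letter (L2) of the pub-balaban NE9 letter map at the Hilbert-space level.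
[cite: Balaban1985BackgroundPropagators, (3.153) p.426; Balaban1985Variational, (110)–(111) p.294] -/
def frakG : E →ₗ[ℝ] E :=
  G1 Δ D R Dstar Q Qadj a hpos - G1 Δ D R Dstar Q Qadj a hpos ∘ₗ D ∘ₗ R ∘ₗ Dstar ∘ₗ G1 Δ D R Dstar Q Qadj a hpos -
    G1 Δ D R Dstar Q Qadj a hpos ∘ₗ Qadj ∘ₗ Kinv hpos hadj hQadj ∘ₗ Q ∘ₗ G1 Δ D R Dstar Q Qadj a hpos

/-- Unfolding 𝔓. [cite: Balaban1985BackgroundPropagators, (3.147) p.425] -/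
theorem frakP_apply (x : E) : frakP hpos hadj hQadj x =
    x - G1 Δ D R Dstar Q Qadj a hpos (Qadj (Kinv hpos hadj hQadj (Q x))) - G1 Δ D R Dstar Q Qadj a hpos (D (R (Dstar x))) := rfl

/-- Unfolding 𝔓*. [cite: Balaban1985BackgroundPropagators, (3.153) p.426] -/
theorem frakPstar_apply (x : E) : frakPstar hpos hadj hQadj x =
    x - Qadj (Kinv hpos hadj hQadj (Q (G1 Δ D R Dstar Q Qadj a hpos x))) - D (R (Dstar (G1 Δ D R Dstar Q Qadj a hpos x))) := rfl

/-- Unfolding 𝔊. [cite: Balaban1985BackgroundPropagators, (3.153) p.426] -/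
theorem frakG_apply (x : E) : frakG hpos hadj hQadj x =
    G1 Δ D R Dstar Q Qadj a hpos x - G1 Δ D R Dstar Q Qadj a hpos (D (R (Dstar (G1 Δ D R Dstar Q Qadj a hpos x)))) -
      G1 Δ D R Dstar Q Qadj a hpos (Qadj (Kinv hpos hadj hQadj (Q (G1 Δ D R Dstar Q Qadj a hpos x)))) := rfl

/-- **(3.153), last equality: `𝔊 = G₁𝔓*`** — here hypothesis-free (an identity between the definitions; the tree's `B9.frakG_3153` second
conjunct). [cite: Balaban1985BackgroundPropagators, (3.153) p.426; Balaban1985Variational, p.294] -/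
theorem frakG_eq_G1_comp_frakPstar : frakG hpos hadj hQadj = G1 Δ D R Dstar Q Qadj a hpos ∘ₗ frakPstar hpos hadj hQadj := by
  apply LinearMap.ext; intro x
  rw [LinearMap.comp_apply, frakPstar_apply, frakG_apply, map_sub, map_sub]
  abel

/-- **`G₁𝔓* = 𝔓G₁`** (the two factorizations of 𝔊 in (3.153)) — hypothesis-free. [cite: Balaban1985BackgroundPropagators, (3.153) p.426] -/
theorem G1_comp_frakPstar_eq_frakP_comp_G1 :
    G1 Δ D R Dstar Q Qadj a hpos ∘ₗ frakPstar hpos hadj hQadj = frakP hpos hadj hQadj ∘ₗ G1 Δ D R Dstar Q Qadj a hpos := by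
  apply LinearMap.ext; intro x
  rw [LinearMap.comp_apply, LinearMap.comp_apply, frakPstar_apply, frakP_apply, map_sub, map_sub]

/-! ## §2 The printed properties `Q𝔓 = 0`, `RD*𝔓 = 0`, `𝔓² = 𝔓`, `Q𝔊 = 0`, `RD*𝔊 = 0` from the identities (3.124) / «RD*G₁DR = R» -/

/-- **p. 425 «Q𝔓 = 0»**: from `(QG₁Q*)(QG₁Q*)⁻¹ = I` (here BY CONSTRUCTION, `hK_holds`) and the identity (3.124) for `G₁`, `QG₁DR = 0` (displayed
hypothesis `h124`). [cite: Balaban1985BackgroundPropagators, p.425, (3.124) p.420] -/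
theorem Q_frakP (h124 : Q ∘ₗ G1 Δ D R Dstar Q Qadj a hpos ∘ₗ D ∘ₗ R = 0) (x : E) : Q (frakP hpos hadj hQadj x) = 0 := by
  have h := LinearMap.congr_fun h124 (Dstar x)
  simp only [LinearMap.comp_apply, LinearMap.zero_apply] at h
  rw [frakP_apply, map_sub, map_sub, hK_holds, h, sub_self, zero_sub, neg_eq_zero]

/-- **p. 425 «RD*𝔓 = 0»**: from (3.124) for `G₁` in the form `RD*G₁Q* = 0` and «`RD*G₁DR = R`» (displayed hypotheses).
[cite: Balaban1985BackgroundPropagators, p.425, (3.124) p.420] -/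
theorem RDstar_frakP (h124' : R ∘ₗ Dstar ∘ₗ G1 Δ D R Dstar Q Qadj a hpos ∘ₗ Qadj = 0)
    (hR : R ∘ₗ Dstar ∘ₗ G1 Δ D R Dstar Q Qadj a hpos ∘ₗ D ∘ₗ R = R) (x : E) : R (Dstar (frakP hpos hadj hQadj x)) = 0 := by
  have h1 := LinearMap.congr_fun h124' (Kinv hpos hadj hQadj (Q x))
  have h2 := LinearMap.congr_fun hR (Dstar x)
  simp only [LinearMap.comp_apply, LinearMap.zero_apply] at h1 h2
  rw [frakP_apply, map_sub, map_sub, map_sub, map_sub, h1, h2, sub_zero, sub_self]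

/-- **p. 425 «𝔓² = 𝔓»** from `Q𝔓 = 0` and `RD*𝔓 = 0`. [cite: Balaban1985BackgroundPropagators, p.425] -/
theorem frakP_idem (hQ : ∀ x, Q (frakP hpos hadj hQadj x) = 0) (hRD : ∀ x, R (Dstar (frakP hpos hadj hQadj x)) = 0) (x : E) :
    frakP hpos hadj hQadj (frakP hpos hadj hQadj x) = frakP hpos hadj hQadj x := by
  conv_lhs => rw [frakP_apply]
  rw [hQ, map_zero, map_zero, map_zero, sub_zero, hRD, map_zero, map_zero, sub_zero]

/-- **[B11] p. 294 «satisfying the equalities Q𝔊 = 0 …»**: `Q𝔊 = 0` from (3.124) `QG₁DR = 0` (the `(QG₁Q*)(QG₁Q*)⁻¹ = I` step is by construction).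
[cite: Balaban1985Variational, p.294; Balaban1985BackgroundPropagators, (3.153) p.426] -/
theorem Q_frakG (h124 : Q ∘ₗ G1 Δ D R Dstar Q Qadj a hpos ∘ₗ D ∘ₗ R = 0) (x : E) : Q (frakG hpos hadj hQadj x) = 0 := by
  have h := LinearMap.congr_fun h124 (Dstar (G1 Δ D R Dstar Q Qadj a hpos x))
  simp only [LinearMap.comp_apply, LinearMap.zero_apply] at h
  rw [frakG_apply, map_sub, map_sub, hK_holds, h, sub_zero, sub_self]

/-- **[B11] p. 294 «… RD*𝔊 = 0»**: from `RD*G₁Q* = 0` and «`RD*G₁DR = R`». [cite: Balaban1985Variational, p.294; Balaban1985BackgroundPropagators, (3.153) p.426] -/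
theorem RDstar_frakG (h124' : R ∘ₗ Dstar ∘ₗ G1 Δ D R Dstar Q Qadj a hpos ∘ₗ Qadj = 0)
    (hR : R ∘ₗ Dstar ∘ₗ G1 Δ D R Dstar Q Qadj a hpos ∘ₗ D ∘ₗ R = R) (x : E) : R (Dstar (frakG hpos hadj hQadj x)) = 0 := by
  have h1 := LinearMap.congr_fun h124' (Kinv hpos hadj hQadj (Q (G1 Δ D R Dstar Q Qadj a hpos x)))
  have h2 := LinearMap.congr_fun hR (Dstar (G1 Δ D R Dstar Q Qadj a hpos x))
  simp only [LinearMap.comp_apply, LinearMap.zero_apply] at h1 h2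
  rw [frakG_apply, map_sub, map_sub, map_sub, map_sub, h1, h2, sub_zero, sub_self]

/-- **(110) ⇒ (111)**: for `A₁ = −𝔊Y` (any `Y`), the constraints (109) `QA₁ = 0`, `RD*A₁ = 0` hold automatically — [B11] p. 294 *«Thus any solution
of (110) satisfies automatically Eq. (108), (109)»*, under the two (3.124)-type identities. [cite: Balaban1985Variational, (109)–(111) p.294] -/
theorem constraints_of_range_frakG (h124 : Q ∘ₗ G1 Δ D R Dstar Q Qadj a hpos ∘ₗ D ∘ₗ R = 0)
    (h124' : R ∘ₗ Dstar ∘ₗ G1 Δ D R Dstar Q Qadj a hpos ∘ₗ Qadj = 0) (hR : R ∘ₗ Dstar ∘ₗ G1 Δ D R Dstar Q Qadj a hpos ∘ₗ D ∘ₗ R = R)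
    (Y : E) : Q (-(frakG hpos hadj hQadj Y)) = 0 ∧ R (Dstar (-(frakG hpos hadj hQadj Y))) = 0 := by
  refine ⟨?_, ?_⟩
  · rw [map_neg, Q_frakG hpos hadj hQadj h124, neg_zero]
  · rw [map_neg, map_neg, RDstar_frakG hpos hadj hQadj h124' hR, neg_zero]

/-! ## §3 As continuous linear maps (finite dimension) -/

/-- 𝔊 as a CONTINUOUS linear map of the finite-dimensional configuration space — the shape `𝒢 : 𝒵 →L 𝒴` in which `B11Eq174Chart.Regime` /
`B11Prop6Scheme` consume it (their bound `‖𝔊f‖ ≤ B₀‖f‖` = [B9] Thm 3.13 stays displayed; the passage to the sup-normed complex carriers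
`B11Eq115Space` is bookkeeping on the same underlying function space, not done here). [cite: Balaban1985Variational, (117) p.295] -/
def frakGCLM : E →L[ℝ] E := LinearMap.toContinuousLinearMap (frakG hpos hadj hQadj)

/-- Unfolding. [cite: Balaban1985Variational, (117) p.295] -/
theorem frakGCLM_apply (x : E) : frakGCLM hpos hadj hQadj x = frakG hpos hadj hQadj x := rfl

/-- `H₁` as a continuous linear map (finite dimension). [cite: Balaban1985Variational, (103) p.293] -/
def H1CLM : F →L[ℝ] E := LinearMap.toContinuousLinearMap (H1 hpos hadj hQadj)

/-- Unfolding. [cite: Balaban1985Variational, (103) p.293] -/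
theorem H1CLM_apply (b : F) : H1CLM hpos hadj hQadj b = H1 hpos hadj hQadj b := rfl

end Literature.MathematicalPhysics.QuantumFieldTheory.Balaban1983to89.B9Eq3147ProjectionOps

end
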